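import Summits.BirchSwinnertonDyer.BirchSwinnertonDyer.Theorems.KimAtThreeDeepUpperLedgerLatticeIndex
import Summits.BirchSwinnertonDyer.BirchSwinnertonDyer.Theorems.KimAtThreeDeepUpperSupplyGlue
import HarnessLib

/-!
# Route `KimAtThreeKolyvagin` (rung W2), crux `DeepUpperAtThree`: the Kato side ASSEMBLED from
# per-depth cohomological witnesses (upper ledger + `Sel = Ш` at depth + supply ledger + glue)

Cell `bsd-addord`, seat `bsd-addord-w2-c3` (D-0074 row B6), item `stmt-BirchSwinnertonDyer-19076`.
ONE theorem, `deepUpper_conclusion_of_cohomologicalWitnesses`: on a row with `∂⁽⁰⁾(δ̃) = a`,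
`p`-integral plus symbols, IF every depth
`k > a − ord_p #Ш(p)` carries a WITNESS PACKAGE at some level `K = k′ + 1 ≥ k` —
* at the EMPTY level: the dictionary functional `Λ` (kernel clause), the Poitou–Tate count
  `#H¹_{𝓕_can} = p^K · p^{n₀}`, Kato's bottom class `κ_∅ = (p^α b) • g` (`p ∤ b`) with value
  `p^{e₁} · Λ(loc κ_∅) = u · p^{e₂} · (p^a · w₀)` (`e₂ + a < K`), the STUB decomposition
  `g = p^{n₀} • e + m` (`e ∈ H¹_{𝓕_can}`, `m ∈ Sel_{p^K}`), and the deep identification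
  `#Sel_{p^K}(E/ℚ) = #Ш(E/ℚ)[p^∞]` (`KimAtThreeDeepUpperSelmerSha`, rank `0`, `E[p]` irreducible,
  `#Ш[p^∞] ∣ p^K`);
* at a GOOD CORE VERTEX: a cyclic `n ∈ 𝒩_k(E,p)` with `ν(n) ≤ B`, a subgroup `H` (`= H¹_{𝓕_can(n)}`)
  of any abelian group with an additive `L` (`= Λ_n ∘ loc_p`) injective on it, a class `g_n ∈ H` of
  order `p^K`, Kato's class `z_n = (p^α b) • g_n` (THE SAME scalar), surjective `ψ` modulo `p^K` and
  the dictionary value `p^{e₁} · L z_n = u_n · p^{e₂} · δ̃^{(K)}_n(ψ)`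
— THEN `∃ d, ∂^{(∞)}_{deep}(δ̃) = d ∧ ord_p #Ш(E/ℚ)(p) + d ≤ ∂⁽⁰⁾(δ̃)`: the conclusion of crux 19076 at
the row (at `p = 3`). Proof = `LatticeIndex.natCard_selmerGroup_kummer_dvd_pow_of_stub_of_kato₂`
(`#Sel_{p^K} ∣ p^{e₂+a−e₁−α}`) + the `Sel = Ш` witness (`ord_p #Ш(p) ≤ e₂+a−e₁−α`) + `LatticeIndex.exists_eq_pow_mul_unit_of_goodCoreVertex₂`
(`δ̃_n = p^{e₁+α−e₂} · unit`) + `deepUpper_conclusion_of_supplyWitnesses_bounded`.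

So the Kato side of crux 19076 is, in the kernel, EXACTLY the production of these witnesses at every
depth: the dictionary port (n1011 `KatoKuriharaPortThreeAt`, at `∅` and at `n`; two-exponent form on
Kodaira IV/IV*), [S24] Thm. 4.4 (1) (generators `g`, `g_n`, Kato's `z = a′ • κ⁰`), the STUB port at `∅`
(Rubin 2011 Thm. 2.8.4, a port at `p = 3`), and good core vertices at every depth (Chebotarev).
TOOL theorem; nothing asserted about any curve. [cite: Kim2022StructureSelmer, Thm. 1.9 (6), Thm. 3.13]
[cite: MazurRubin2004, Thm. 4.3.4, Cor. 4.1.9, Thm. 5.2.12] [cite: Rubin2011, Thm. 2.8.4 (p. 25)]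
[cite: Sakamoto2024, Thm. 4.4 (p. 926)] [cite: Kim2025RefinedTNC, Thm 1.1, §5]
-/

set_option autoImplicit false
-- the Theorems namespace of a single-conjunct summit repeats the summit name by design (D-0017)
set_option linter.dupNamespace false

noncomputable section

open scoped MatrixGroups ModularForm Classical NumberField
open NumberField IsDedekindDomain CongruenceSubgroup WeierstrassCurve
  Literature.NumberTheory.EllipticCurves Literature.NumberTheory.EllipticCurves.ModularForms
  Literature.NumberTheory.GaloisRepresentations
  Literature.NumberTheory.GaloisRepresentations.DiscreteGaloisModule Literature.NumberTheory.GaloisCohomology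

namespace Summit.BirchSwinnertonDyer.BirchSwinnertonDyer.Theorems.KimAtThreeDeepUpperWitnessAssembly

open Summit.BirchSwinnertonDyer.Rank1Residual.GaloisImage
open Summit.BirchSwinnertonDyer.BirchSwinnertonDyer.Theorems
open KimAtThreeDeepUpperLedgerLatticeIndex KimAtThreeDeepUpperSupplyGlue

/-- **Crux 19076 at a row from per-depth cohomological witnesses** (see the module docstring for the
witness package; `s = ord_p #Ш(E/ℚ)(p)`, `a = ∂⁽⁰⁾(δ̃)`). The scalar `(p^α b)` and the exponents
`e₁, e₂` are THE SAME at the empty level and at the vertex (one Kolyvagin system `z = a′ • κ⁰` at the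
level `K`; one dictionary law). [cite: Kim2022StructureSelmer, Thm. 1.9 (6), Thm. 3.13]
[cite: MazurRubin2004, Thm. 4.3.4, Thm. 5.2.12 (v)] [cite: Kim2025RefinedTNC, Thm 1.1, Lemma 5.2] -/
theorem deepUpper_conclusion_of_cohomologicalWitnesses
    (W : WeierstrassCurve ℚ) [W.IsElliptic] [W.IsGloballyMinimal]
    (p : ℕ) [hp : Fact p.Prime] (hp2 : p ≠ 2)
    {N : ℕ} (f : CuspForm (Gamma0 N) 2)
    (hint : ∀ r : ℚ, ratPlusSymbol f r ≠ 0 → 0 ≤ padicValRat p (ratPlusSymbol f r))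
    {a : ℕ} (ha : kuriharaPartial W p f 0 = a) (B : ℕ)
    (hW : ∀ k, a - padicValNat p (Nat.card (AddCommGroup.primaryComponent W.sha p)) < k →
      ∃ (k' : ℕ) (_ : k ≤ k' + 1)
        -- the empty level at `K = k' + 1`
        (v₀ : HeightOneSpectrum (𝓞 ℚ)) (_ : ((p : ℕ) : 𝓞 ℚ) ∈ v₀.asIdeal)
        (Λ : galoisCohomology ((W.torsionGaloisModule ((p : ℤ) ^ k' * (p : ℤ))).toLocal (Sum.inr v₀)) 1
          →+ ZMod (p ^ (k' + 1)))
        (_ : ∀ x ∈ propagatedSelmerStructure W p k' (Sum.inr v₀),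
          Λ x = 0 ↔ x ∈ W.kummerSelmerStructure ((p : ℤ) ^ k' * (p : ℤ)) (Sum.inr v₀))
        (κ₀ g e m : galoisCohomology (W.torsionGaloisModule ((p : ℤ) ^ k' * (p : ℤ))) 1)
        (e₁ e₂ α b n₀ : ℕ) (u w₀ : (ZMod (p ^ (k' + 1)))ˣ)
        (_ : e₂ + a < k' + 1) (_ : ¬ p ∣ b)
        (_ : ((p ^ e₁ : ℕ) : ZMod (p ^ (k' + 1))) *
            Λ (galoisCohomology.localization _ (Sum.inr v₀) 1 κ₀) =
          (u : ZMod (p ^ (k' + 1))) * ((p ^ e₂ : ℕ) : ZMod (p ^ (k' + 1))) *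
            (((p ^ a : ℕ) : ZMod (p ^ (k' + 1))) * (w₀ : ZMod _)))
        (_ : κ₀ = (p ^ α * b) • g)
        (_ : Nat.card (propagatedSelmerStructure W p k').selmerGroup = p ^ (k' + 1) * p ^ n₀)
        (_ : e ∈ (propagatedSelmerStructure W p k').selmerGroup)
        (_ : m ∈ (W.kummerSelmerStructure ((p : ℤ) ^ k' * (p : ℤ))).selmerGroup)
        (_ : g = p ^ n₀ • e + m)
        (_ : Nat.card (W.kummerSelmerStructure ((p : ℤ) ^ k' * (p : ℤ))).selmerGroup =
          Nat.card (AddCommGroup.primaryComponent W.sha p))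
        -- the good core vertex at the same level
        (n : ℕ) (_ : NeZero n) (_ : IsCyclicKolyvaginLevel W p n) (_ : Kato.IsKolyvaginProduct W p k n)
        (_ : n.primeFactors.card ≤ B)
        (L : galoisCohomology (W.torsionGaloisModule ((p : ℤ) ^ k' * (p : ℤ))) 1 →+ ZMod (p ^ (k' + 1)))
        (H : AddSubgroup (galoisCohomology (W.torsionGaloisModule ((p : ℤ) ^ k' * (p : ℤ))) 1))
        (_ : ∀ x ∈ H, L x = 0 → x = 0)
        (gn zn : galoisCohomology (W.torsionGaloisModule ((p : ℤ) ^ k' * (p : ℤ))) 1)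
        (_ : gn ∈ H) (_ : addOrderOf gn = p ^ (k' + 1))
        (_ : zn = (p ^ α * b) • gn) (un : (ZMod (p ^ (k' + 1)))ˣ)
        (ψ : (ℓ : ℕ) → (ZMod ℓ)ˣ →* Multiplicative (ZMod (p ^ (k' + 1))))
        (_ : ∀ ℓ ∈ n.primeFactors, Function.Surjective (ψ ℓ)),
        ((p ^ e₁ : ℕ) : ZMod (p ^ (k' + 1))) * L zn =
          (un : ZMod (p ^ (k' + 1))) * ((p ^ e₂ : ℕ) : ZMod (p ^ (k' + 1))) *
            (haveI : NeZero n := ‹NeZero n›; kuriharaNumber f (p ^ (k' + 1)) n ψ)) :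
    ∃ d : ℕ, kuriharaPartialDeepInfty W p f = d ∧
      ((padicValNat p (Nat.card (AddCommGroup.primaryComponent W.sha p)) + d : ℕ) : ℕ∞) ≤
        kuriharaPartial W p f 0 := by
  set s := padicValNat p (Nat.card (AddCommGroup.primaryComponent W.sha p)) with hs_def
  -- `s ≤ a` from ANY witness (take the one at depth `a - s + 1`)
  have hmain : ∀ k, a - s < k → ∃ (n : ℕ) (_ : NeZero n), IsCyclicKolyvaginLevel W p n ∧
      Kato.IsKolyvaginProduct W p k n ∧ n.primeFactors.card ≤ B ∧
      ∃ (K γ : ℕ) (ψ : (ℓ : ℕ) → (ZMod ℓ)ˣ →* Multiplicative (ZMod (p ^ K))) (w : (ZMod (p ^ K))ˣ),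
        γ ≤ a - s ∧ γ < K ∧ (∀ ℓ ∈ n.primeFactors, Function.Surjective (ψ ℓ)) ∧
        kuriharaNumber f (p ^ K) n ψ = ((p ^ γ : ℕ) : ZMod (p ^ K)) * (w : ZMod (p ^ K)) ∧ s ≤ a := by
    intro k hk
    obtain ⟨k', hkk', v₀, hv₀, Λ, hker, κ₀, g, e, m, e₁, e₂, α, b, n₀, u, w₀, hK, hb, hdict₀, ha', hcount,
      he, hm, hstub, hSha, n, hn0, hcyc, hn, hB, L, H, hinj, gn, zn, hgn, hord, hzn, un, ψ, hψ,
      hdictn⟩ := hW k hk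
    haveI : NeZero n := hn0
    -- upper ledger (two-exponent) at `∅`
    obtain ⟨hle, hup⟩ := LatticeIndex.natCard_selmerGroup_kummer_dvd_pow_of_stub_of_kato₂ W p k' hp2
      hv₀ Λ hker (κ₀ := κ₀) (κ₀' := κ₀) rfl hK u w₀ (δ₁ := ((p ^ a : ℕ) : ZMod (p ^ (k' + 1))) * (w₀ : ZMod _))
      rfl hdict₀ hb ha' hcount he hm hstub
    -- `Sel = Ш` at depth (witness `hSha`): `s ≤ e₂ + a − (e₁ + α)`
    have hsle : s ≤ e₂ + a - (e₁ + α) := by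
      rw [hSha] at hup
      obtain ⟨i, hi, hcard⟩ := (Nat.dvd_prime_pow hp.out).1 hup
      rw [hs_def, hcard, padicValNat.prime_pow]
      exact hi
    -- supply ledger (two-exponent) at the vertex
    obtain ⟨hle', w, hw⟩ := LatticeIndex.exists_eq_pow_mul_unit_of_goodCoreVertex₂ L H hinj hgn hord
      hb (by omega) hzn un hdictn
    refine ⟨n, hn0, hcyc, hn, hB, k' + 1, e₁ + α - e₂, ψ, w, ?_, by omega, hψ, hw, ?_⟩
    · -- `γ = e₁ + α − e₂ ≤ a − s`
      have : s ≤ e₂ + a - (e₁ + α) := hsle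
      omega
    · have : s ≤ e₂ + a - (e₁ + α) := hsle
      omega
  have hsa : s ≤ a := by
    obtain ⟨-, -, -, -, -, -, -, -, -, -, -, -, -, h⟩ := hmain (a - s + 1) (by omega)
    exact h
  exact deepUpper_conclusion_of_supplyWitnesses_bounded W p f hint ha hsa B fun k hk => by
    obtain ⟨n, hn0, hcyc, hn, hB, K, γ, ψ, w, hγ, hγK, hψ, hw, -⟩ := hmain k hk
    exact ⟨n, hn0, hcyc, hn, hB, K, γ, ψ, w, hγ, hγK, hψ, hw⟩

/-! ### Appended 2026-08-26 (same seat): the ITEM-LEVEL reading at `p = 3` -/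

open Summit.BirchSwinnertonDyer.BirchSwinnertonDyer.Theses.KimAtThreeKolyvagin
open KimAtThreeKolyvaginUnitLevelOneRungs in
/-- **Crux `DeepUpperAtThree` ⟸ witness packages on every row.** If on EVERY row of the crux
(`W/ℚ` globally minimal with the `3`-adic tower onto, `Ш(E/ℚ)` finite, `f` the newform with
`3`-integral plus symbols and `ord(δ̃) = 0`) and for every depth `k > ∂⁽⁰⁾(δ̃) − ord₃ #Ш(E/ℚ)(3)` the
cohomological witness package of `deepUpper_conclusion_of_cohomologicalWitnesses` exists (hypothesis
`H`, spelled inline; the bound `B` on `ν` may depend on the row), then `DeepUpperAtThree` holds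
OUTRIGHT. So item 19076 = the production of these packages (dictionary port, [S24] generators, STUB at
`∅`, good core vertices) on every tower row. [cite: Kim2025RefinedTNC, Thm 1.1]
[cite: MazurRubin2004, Thm. 4.3.4, Thm. 5.2.12 (v)] -/
theorem deepUpperAtThree_of_cohomologicalWitnesses
    (H : ∀ (W : WeierstrassCurve ℚ) [W.IsElliptic] [W.IsGloballyMinimal],
      (∀ n : ℕ, W.HasSurjectiveModNGaloisRep (3 ^ n : ℕ)) → Finite W.sha →
      ∀ {N : ℕ} [NeZero N] (f : CuspForm (Gamma0 N) 2), IsNewformOf W f →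
      (∀ r : ℚ, ratPlusSymbol f r ≠ 0 → 0 ≤ padicValRat 3 (ratPlusSymbol f r)) →
      kuriharaVanishingOrder W 3 f = 0 → ∀ a : ℕ, kuriharaPartial W 3 f 0 = a → ∃ B : ℕ,
      ∀ k, a - padicValNat 3 (Nat.card (AddCommGroup.primaryComponent W.sha 3)) < k →
      ∃ (k' : ℕ) (_ : k ≤ k' + 1)
        (v₀ : HeightOneSpectrum (𝓞 ℚ)) (_ : ((3 : ℕ) : 𝓞 ℚ) ∈ v₀.asIdeal)
        (Λ : galoisCohomology ((W.torsionGaloisModule (((3 : ℕ) : ℤ) ^ k' * ((3 : ℕ) : ℤ))).toLocal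
          (Sum.inr v₀)) 1 →+ ZMod (3 ^ (k' + 1)))
        (_ : ∀ x ∈ propagatedSelmerStructure W 3 k' (Sum.inr v₀),
          Λ x = 0 ↔ x ∈ W.kummerSelmerStructure (((3 : ℕ) : ℤ) ^ k' * ((3 : ℕ) : ℤ)) (Sum.inr v₀))
        (κ₀ g e m : galoisCohomology (W.torsionGaloisModule (((3 : ℕ) : ℤ) ^ k' * ((3 : ℕ) : ℤ))) 1)
        (e₁ e₂ α b n₀ : ℕ) (u w₀ : (ZMod (3 ^ (k' + 1)))ˣ)
        (_ : e₂ + a < k' + 1) (_ : ¬ 3 ∣ b)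
        (_ : ((3 ^ e₁ : ℕ) : ZMod (3 ^ (k' + 1))) *
            Λ (galoisCohomology.localization _ (Sum.inr v₀) 1 κ₀) =
          (u : ZMod (3 ^ (k' + 1))) * ((3 ^ e₂ : ℕ) : ZMod (3 ^ (k' + 1))) *
            (((3 ^ a : ℕ) : ZMod (3 ^ (k' + 1))) * (w₀ : ZMod _)))
        (_ : κ₀ = (3 ^ α * b) • g)
        (_ : Nat.card (propagatedSelmerStructure W 3 k').selmerGroup = 3 ^ (k' + 1) * 3 ^ n₀)
        (_ : e ∈ (propagatedSelmerStructure W 3 k').selmerGroup)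
        (_ : m ∈ (W.kummerSelmerStructure (((3 : ℕ) : ℤ) ^ k' * ((3 : ℕ) : ℤ))).selmerGroup)
        (_ : g = 3 ^ n₀ • e + m)
        (_ : Nat.card (W.kummerSelmerStructure (((3 : ℕ) : ℤ) ^ k' * ((3 : ℕ) : ℤ))).selmerGroup =
          Nat.card (AddCommGroup.primaryComponent W.sha 3))
        (n : ℕ) (_ : NeZero n) (_ : IsCyclicKolyvaginLevel W 3 n) (_ : Kato.IsKolyvaginProduct W 3 k n)
        (_ : n.primeFactors.card ≤ B)
        (L : galoisCohomology (W.torsionGaloisModule (((3 : ℕ) : ℤ) ^ k' * ((3 : ℕ) : ℤ))) 1 →+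
          ZMod (3 ^ (k' + 1)))
        (H : AddSubgroup (galoisCohomology (W.torsionGaloisModule (((3 : ℕ) : ℤ) ^ k' * ((3 : ℕ) : ℤ))) 1))
        (_ : ∀ x ∈ H, L x = 0 → x = 0)
        (gn zn : galoisCohomology (W.torsionGaloisModule (((3 : ℕ) : ℤ) ^ k' * ((3 : ℕ) : ℤ))) 1)
        (_ : gn ∈ H) (_ : addOrderOf gn = 3 ^ (k' + 1))
        (_ : zn = (3 ^ α * b) • gn) (un : (ZMod (3 ^ (k' + 1)))ˣ)
        (ψ : (ℓ : ℕ) → (ZMod ℓ)ˣ →* Multiplicative (ZMod (3 ^ (k' + 1))))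
        (_ : ∀ ℓ ∈ n.primeFactors, Function.Surjective (ψ ℓ)),
        ((3 ^ e₁ : ℕ) : ZMod (3 ^ (k' + 1))) * L zn =
          (un : ZMod (3 ^ (k' + 1))) * ((3 ^ e₂ : ℕ) : ZMod (3 ^ (k' + 1))) *
            (haveI : NeZero n := ‹NeZero n›; kuriharaNumber f (3 ^ (k' + 1)) n ψ)) :
    DeepUpperAtThree := by
  intro W _ _ htower hfin N _ f hf hint hord
  haveI : Fact (Nat.Prime 3) := ⟨Nat.prime_three⟩
  -- `∂⁽⁰⁾(δ̃) = a` is finite in analytic rank `0`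
  have hfin0 : kuriharaPartial W 3 f 0 < ⊤ := by
    rw [kuriharaPartial_zero]
    exact kuriharaDivIndex_one_lt_top_of_kuriharaVanishingOrder_eq_zero W 3 f hord
  obtain ⟨a, ha⟩ : ∃ a : ℕ, kuriharaPartial W 3 f 0 = a :=
    (ENat.ne_top_iff_exists.mp hfin0.ne).imp fun a h => h.symm
  obtain ⟨B, hW⟩ := H W htower hfin f hf hint hord a ha
  exact deepUpper_conclusion_of_cohomologicalWitnesses W 3 (by norm_num) f hint ha B hW

end Summit.BirchSwinnertonDyer.BirchSwinnertonDyer.Theorems.KimAtThreeDeepUpperWitnessAssembly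

end
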